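import Literature.NumberTheory.Automorphic.ResGLnCohomology
import Literature.NumberTheory.Automorphic.CuspidalCohomologyGLRankOneProofs
import Literature.NumberTheory.Automorphic.CuspidalCohomologyGLRankOneCharacter
import Literature.NumberTheory.Automorphic.ReciprocityGLnRankOneProofs
import Literature.NumberTheory.Automorphic.GLOneArchParameterOfAlgebraicCharacter
import Literature.NumberTheory.Automorphic.ClozelAlgebraicity
import Literature.NumberTheory.GaloisRepresentations.HeckeCharacterAutConj
import Literature.NumberTheory.GaloisRepresentations.AlgebraicHeckeCharacterGrossencharakterProofs
import Literature.Barriers.Langlands.NonRegularWeightBarrier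
import Mathlib.LinearAlgebra.PiTensorProduct.Dual
import HarnessLib

/-!
# Cuspidal eigenclasses in the cohomology of `Res_{K/ℚ} GL_n`: the rank-one case of
# `ResGLnCohomology.cuspidalEigenclass_exists` (any number field `K`), proved

Topic `NumberTheory/Automorphic`; proof file (theorems only: no definition, no named fact, no
instance) under the named fact `Literature.NumberTheory.Automorphic.ResGLnCohomology.cuspidalEigenclass_exists`
(`ResGLnCuspidalEigenclass.lean`; Clozel Lemme 3.15 / Borel / Franke: a cuspidal `π` on `GL_n(𝔸_K)`
of cohomological type with a `K(𝔫)`-fixed vector has a non-zero simultaneous `T_{v,i}`-eigenclass in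
some `H^q(S_{K_f(𝔫)}, Ẽ_λ) = ResGLnCohomology.levelCohomology ℂ n K 𝔫 λ q` with the
Satake–Tamagawa eigenvalues).  The twin over `ℚ` has its rank-one case proved
(`GLnCohomology.cuspidalEigenclass_exists_rank_one`, `CuspidalCohomologyGLRankOneHolds.lean`); this
file proves the **rank-one case over EVERY number field `K`** on the `Res` carrier, which is also a
check of the conventions of the fact (the weight `λ_τ` of the coefficient line `det^{λ_τ}` at the
embedding `τ` versus the `a`-exponent `λ_τ^∨(0) + ρ = -λ_τ` of the infinity type; the orientation of
the Hecke operators):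

* `ResGLnCohomology.exists_finiteCharacter_of_cuspidal_glOne` — **automorphic side**: for a
  cuspidal `π` on `GL₁(𝔸_K)` with an infinity type whose `a`-multiset at `τ` is `{-λ_τ}` and a
  `K(𝔫)`-fixed form, the finite part `χ = ω_π ∘ (1, ·)` of its Hecke character
  (`AutomorphicRepData.exists_heckeCharacter_glOne`) is trivial on `K_f(𝔫)`, equals
  `∏_τ τ(γ)^{λ_τ}` on `γ ∈ GL₁(K)⁺` (the Hecke character is trivial on principal ideles,
  `HeckeCharacter.map_principal`, and equals `∏_τ τ(·)^{-λ_τ}` on totally positive infinite ideles: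
  `exists_hasInfinityType_heckeCharacter_glOne`, `map_a_eq_of_hasInfinityType_heckeCharacter_glOne`,
  `HasInfinityType.apply_globalToInfiniteUnits_eq`, `prod_embedding_zpow_eq`), and takes the
  Satake–Tamagawa values at the `t_{v,i}`, `v ∤ 𝔫`
  (`quasiCharacter_heckeElement_eq_of_hasSatakeParamAt`) [cite: Clozel1990, §1.1 and §3.3 (n = 1)];
* `ResGLnCohomology.exists_eigenclass_of_finiteCharacter_glOne` — **cohomological side**: such a
  character gives the non-zero class of `c ↦ χ(c) w₀` in `H⁰(S_{K_f(𝔫)}, Ẽ_λ)` with `T_g x = χ(g) x`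
  (`TwistedQuotient.exists_eigenclass_of_character`; `GL₁(𝔸_K^∞)` is commutative and `GL₁(K)⁺` acts
  on the line `E_λ(ℂ) = ⊗_τ det^{λ_τ}` by `∏_τ τ(γ)^{λ_τ}`) [cite: RaghuramShahidi2010, §2.2];
* `ResGLnCohomology.cuspidalEigenclass_exists_rank_one` — **the named fact with `n = 1`**, binders
  verbatim.

(The same two halves were first landed problem-side as stubs of line `Sketch` of the crux
`Summit.Langlands.Langlands.Theses.IrreducibilityBySelfDuality.HeckeEigenvalueField`, files
`Summits/Langlands/Langlands/Theorems/IrreducibilityBySelfDualityHeckeEigenvalueFieldResGlOne{Character,Eigenclass}.lean`;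
they are re-proved here because Literature does not import Summits.)

## References

* L. Clozel, *Motifs et formes automorphes* (1990), §1.1, §3.3, Lemme 3.15. [Clozel1990]
* A. Raghuram, F. Shahidi, *On certain period relations for cusp forms on `GL_n`*, IMRN 2008,
  §2.2 (Eichler–Shimura–Harder in degree `0`). [RaghuramShahidi2010]
-/

noncomputable section

open scoped Classical ComplexConjugate TensorProduct
open NumberField IsDedekindDomain CategoryTheory

namespace Literature.NumberTheory.Automorphic

namespace ResGLnCohomology

open Literature.NumberTheory.GaloisRepresentations Literature.NumberTheory.DiophantineGeometry
  Literature.Barriers.Langlands BigHeckeGLn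

/-! ### The archimedean side: the exponents of the Hecke character -/

/-- For `n = 1` the `a`-multiset of the cohomological infinity type of `μ` is `{μ₀}`
(`ρ_{GL₁} = 0`). [folklore] -/
private theorem map_a_cohomologicalInfinityType_one {K : Type} [Field K] (μ : Fin 1 → ℤ)
    (τ : K →+* ℂ) :
    (cohomologicalInfinityType 1 K μ τ).map ArchWeight.a = {((μ 0 : ℤ) : ℂ)} := by
  rw [cohomologicalInfinityType_apply, Finset.univ_unique, Fin.default_eq_zero, Finset.singleton_val,
    Multiset.map_singleton, Multiset.map_singleton, cohomologicalArchWeight_a, rhoGL_one, add_zero]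

/-- `λ^∨(0) = -λ(0)` for a weight of `GL₁`. [folklore] -/
private theorem weight_dual_zero_one (μ : Fin 1 → ℤ) : Weight.dual μ 0 = -μ 0 := by
  show -μ (Fin.rev 0) = -μ 0
  rw [Subsingleton.elim (Fin.rev 0 : Fin 1) 0]

/-- A well-formed infinity type `T` of `GL₁` whose `a`-multisets are singletons of integers,
`(T τ).map a = {m_τ}`, is `C`-algebraic: its weight at `τ` is `(m_τ, m_{τ̄})`. [folklore] -/
private theorem isCAlgebraic_of_map_a_eq_singleton {K : Type} [Field K] {T : InfinityType K 1}
    (hTwf : T.IsWellFormed) (m : (K →+* ℂ) → ℤ)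
    (hk : ∀ τ : K →+* ℂ, (T τ).map ArchWeight.a = {((m τ : ℤ) : ℂ)}) : T.IsCAlgebraic := by
  intro σ w hw
  obtain ⟨w₀, hw₀⟩ := Multiset.card_eq_one.1 (hTwf.1 σ)
  rw [hw₀, Multiset.mem_singleton] at hw
  subst hw
  have ha : w.a = ((m σ : ℤ) : ℂ) := by
    have h := hk σ
    rw [hw₀, Multiset.map_singleton] at h
    exact Multiset.singleton_inj.1 h
  have hb : w.b = ((m (ComplexEmbedding.conjugate σ) : ℤ) : ℂ) := by
    have h := hk (ComplexEmbedding.conjugate σ)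
    rw [hTwf.2 σ, hw₀, Multiset.map_singleton, Multiset.map_singleton, ArchWeight.swap_a] at h
    exact Multiset.singleton_inj.1 h
  refine ⟨m σ, m (ComplexEmbedding.conjugate σ), ?_, ?_⟩
  · rw [ha]; push_cast; ring
  · rw [hb]; push_cast; ring

/-- **The exponents of the Hecke character of `π` are read off the archimedean parameter**: if
`π = W / W'` on `GL₁(𝔸_K)` has Hecke character `χ` and an infinity type `T` with
`(T τ).map a = {m_τ}`, `m_τ ∈ ℤ`, then `χ` has an infinity type `(p, q)` whose embedding
exponents are `n_τ = -m_τ` (`exists_hasInfinityType_heckeCharacter_glOne`,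
`map_a_eq_of_hasInfinityType_heckeCharacter_glOne`). [cite: Clozel1990, §3.3 (n = 1)] -/
private theorem exists_hasInfinityType_embExponent_eq {K : Type} [Field K] [NumberField K]
    {hcpt : isCompact_glFiniteIntegralLevel 1 K}
    (π : AutomorphicRepData (AutomorphyDatum.gl 1 K hcpt)) {χ : HeckeCharacter K}
    (hχ : ∀ (g : (AdelicGroupData.gl 1 K).Adelic), ∀ φ ∈ π.W,
      rightTranslation (AdelicGroupData.gl 1 K) g φ -
        ((χ (Matrix.GeneralLinearGroup.det g) : ℂˣ) : ℂ) • φ ∈ π.W')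
    {T : InfinityType K 1} (hT : π.HasInfinityType T) (m : (K →+* ℂ) → ℤ)
    (hk : ∀ τ : K →+* ℂ, (T τ).map ArchWeight.a = {((m τ : ℤ) : ℂ)}) :
    ∃ p q : InfinitePlace K → ℤ, χ.HasInfinityType p q ∧
      ∀ τ : K →+* ℂ, HeckeCharacter.embExponent p q τ = -m τ := by
  obtain ⟨p, q, hpq⟩ := π.exists_hasInfinityType_heckeCharacter_glOne hχ hT
    (isCAlgebraic_of_map_a_eq_singleton hT.1 m hk)
  refine ⟨p, q, hpq, fun τ => ?_⟩
  have h1 := π.map_a_eq_of_hasInfinityType_heckeCharacter_glOne hχ hpq hT τ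
  rw [hk τ, Multiset.singleton_inj] at h1
  have h2 : ((-m τ : ℤ) : ℂ) = ((HeckeCharacter.embExponent p q τ : ℤ) : ℂ) := by
    rw [Int.cast_neg, h1, neg_neg]
  exact_mod_cast h2.symm

/-! ### The principal idele of `det γ` and the value `χ(det (1, γ_f))` -/

/-- For `γ ∈ GL₁(K)` with `k = det γ`: `(k)_∞ · det (1, ι(γ)) = (k)` as ideles. [folklore] -/
private theorem infiniteIdeles_mul_det_ofFinite_globalEmbedding {K : Type} [Field K] [NumberField K]
    (γ : GL (Fin 1) K) :
    infiniteIdeles K (globalToInfiniteUnits K (Matrix.GeneralLinearGroup.det γ)) *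
        Matrix.GeneralLinearGroup.det (GLn.ofFinite 1 K (globalEmbedding 1 K γ)) =
      Literature.NumberTheory.GaloisRepresentations.principalIdele K
        (Matrix.GeneralLinearGroup.det γ) := by
  refine Units.ext (Prod.ext ?_ ?_)
  · rw [ideleGroup_val_fst_mul, infiniteIdeles_fst, val_globalToInfiniteUnits, principalIdele_fst,
      Matrix.GeneralLinearGroup.val_det_apply (GLn.ofFinite 1 K (globalEmbedding 1 K γ)),
      Matrix.det_fin_one, GLn.coe_ofFinite_apply]
    show _ * (1 : Matrix (Fin 1) (Fin 1) (InfiniteAdeleRing K)) 0 0 = _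
    rw [Matrix.one_apply_eq, mul_one]
  · show (1 : FiniteAdeleRing (𝓞 K) K) *
        ((Matrix.GeneralLinearGroup.det (GLn.ofFinite 1 K (globalEmbedding 1 K γ)) : ideleGroup K) :
          AdeleRing (𝓞 K) K).2 =
      algebraMap K (FiniteAdeleRing (𝓞 K) K) ((Matrix.GeneralLinearGroup.det γ : Kˣ) : K)
    rw [one_mul, Matrix.GeneralLinearGroup.val_det_apply (GLn.ofFinite 1 K (globalEmbedding 1 K γ)),
      Matrix.det_fin_one, GLn.coe_ofFinite_apply]
    show algebraMap K (FiniteAdeleRing (𝓞 K) K) ((γ : Matrix (Fin 1) (Fin 1) K) 0 0) = _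
    congr 1
    rw [Matrix.GeneralLinearGroup.val_det_apply, Matrix.det_fin_one]

/-- `χ(det (1, γ_f)) = ∏_τ τ(det γ)^{n_τ}` for `γ ∈ GL₁(K)⁺` when the Hecke character `χ` has
infinity type `(p, q)` with embedding exponents `n_τ` (`χ` is trivial on the principal idele
`(k) = (k)_∞ · det(1, γ_f)`, `k = det γ`, and is `∏_τ τ(k)^{-n_τ}` on the totally positive `(k)_∞`).
[cite: Clozel1990, §1.1 (n = 1)] -/
private theorem heckeCharacter_det_ofFinite_globalEmbedding_eq {K : Type} [Field K] [NumberField K]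
    {χ : HeckeCharacter K} {p q : InfinitePlace K → ℤ} (hpq : χ.HasInfinityType p q)
    (γ : GL (Fin 1) K)
    (hpos : ∀ φ : K →+* ℝ, 0 < φ ((Matrix.GeneralLinearGroup.det γ : Kˣ) : K)) :
    ((χ (Matrix.GeneralLinearGroup.det (GLn.ofFinite 1 K (globalEmbedding 1 K γ))) : ℂˣ) : ℂ) =
      ∏ τ : K →+* ℂ, (τ ((Matrix.GeneralLinearGroup.det γ : Kˣ) : K)) ^
        (HeckeCharacter.embExponent p q τ) := by
  have hmul : ((χ (infiniteIdeles K (globalToInfiniteUnits K (Matrix.GeneralLinearGroup.det γ))) :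
      ℂˣ) : ℂ) *
      ((χ (Matrix.GeneralLinearGroup.det (GLn.ofFinite 1 K (globalEmbedding 1 K γ))) : ℂˣ) : ℂ) =
        1 := by
    rw [← Units.val_mul, ← map_mul, infiniteIdeles_mul_det_ofFinite_globalEmbedding γ,
      χ.map_principal (Literature.NumberTheory.GaloisRepresentations.principalIdele_mem _),
      Units.val_one]
  have hinf : ((χ (infiniteIdeles K (globalToInfiniteUnits K (Matrix.GeneralLinearGroup.det γ))) :
      ℂˣ) : ℂ) =
      ∏ τ : K →+* ℂ, (τ ((Matrix.GeneralLinearGroup.det γ : Kˣ) : K)) ^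
        (-HeckeCharacter.embExponent p q τ) := by
    rw [hpq.apply_globalToInfiniteUnits_eq hpos,
      HeckeCharacter.prod_embedding_zpow_eq p q (Matrix.GeneralLinearGroup.det γ).ne_zero]
  rw [eq_inv_of_mul_eq_one_right hmul, hinf, ← Finset.prod_inv_distrib]
  refine Finset.prod_congr rfl fun τ _ => ?_
  rw [zpow_neg, inv_inv]

/-! ### Automorphic side -/

/-- **The finite Hecke character of a cuspidal `π` on `GL₁(𝔸_K)` of cohomological type.**  For a
cuspidal `π` on `GL₁(𝔸_K)` with an infinity type whose `a`-multiset at every `τ` is that of the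
cohomological type of `λ_τ^∨` (i.e. `{-λ_τ(0)}`) and with a `K(𝔫)`-fixed form off `W'` (`𝔫 ≠ 0`),
there is a character `χ` of `GL₁(𝔸_K^∞)` — the finite part `ω_π ∘ (1, ·)` of its Hecke character
— trivial on `K_f(𝔫)`, equal to `∏_τ τ(det γ)^{λ_τ(0)}` on `γ ∈ GL₁(K)⁺`, and taking at the Hecke
elements `t_{v,i}`, `v ∤ 𝔫`, the Satake–Tamagawa values `heckeEigenvalueOf 1 v α i` of every Satake
parameter `α` of `π` at `v`. [cite: Clozel1990, §1.1 and §3.3 (n = 1)] -/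
theorem exists_finiteCharacter_of_cuspidal_glOne (K : Type) [Field K] [NumberField K]
    (hcpt : isCompact_glFiniteIntegralLevel 1 K) (𝔫 : Ideal (𝓞 K)) (lam : (K →+* ℂ) → Fin 1 → ℤ)
    (h𝔫 : 𝔫 ≠ 0) (π : CuspidalAutomorphicRepData 1 K hcpt)
    (hT : ∃ T : InfinityType K 1, π.1.HasInfinityType T ∧
      ∀ τ : K →+* ℂ, (T τ).map ArchWeight.a =
        (cohomologicalInfinityType 1 K (Weight.dual (lam τ)) τ).map ArchWeight.a)
    (hfix : ∃ φ ∈ π.1.W, φ ∉ π.1.W' ∧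
      ∀ u ∈ principalCongruenceLevel 1 K 𝔫, rightTranslation (AdelicGroupData.gl 1 K) u φ = φ) :
    ∃ χ : FiniteAdelicGL 1 K →* ℂˣ,
      (∀ u ∈ level 1 K 𝔫, χ u = 1) ∧
      (∀ γ : glTotPos 1 K, ((χ (diagPos 1 K γ) : ℂˣ) : ℂ) =
        ∏ τ : K →+* ℂ,
          (τ ((Matrix.GeneralLinearGroup.det (γ : GL (Fin 1) K) : Kˣ) : K)) ^ (lam τ 0)) ∧
      ∀ v : HeightOneSpectrum (𝓞 K), ¬ v.asIdeal ∣ 𝔫 → ∀ α : Multiset ℂ,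
        π.1.HasSatakeParamAt v α → ∀ i ≤ 1,
          ((χ (heckeElement 1 K v i) : ℂˣ) : ℂ) = heckeEigenvalueOf 1 v α i := by
  obtain ⟨T, hT, hTa⟩ := hT
  obtain ⟨φ, hφW, hφW', hφfix⟩ := hfix
  -- the Hecke character of `π` and the quasi-character `ω = χ_π ∘ det` of `GL₁(𝔸_K)`
  obtain ⟨χH, hχH⟩ := π.1.exists_heckeCharacter_glOne
  let ω : (AdelicGroupData.gl 1 K).Adelic →* ℂˣ :=
    (χH : ideleGroup K →* ℂˣ).comp
      (Matrix.GeneralLinearGroup.det : GL (Fin 1) (AdeleRing (𝓞 K) K) →* (AdeleRing (𝓞 K) K)ˣ)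
  have hω : ∀ (g : (AdelicGroupData.gl 1 K).Adelic), ∀ ψ ∈ π.1.W,
      rightTranslation (AdelicGroupData.gl 1 K) g ψ - ((ω g : ℂˣ) : ℂ) • ψ ∈ π.1.W' :=
    fun g ψ hψ => hχH g ψ hψ
  -- `ω` is trivial on `K(𝔫)` (the fixed form `φ`)
  have hωK : ∀ u ∈ principalCongruenceLevel 1 K 𝔫,
      ω (show (AdelicGroupData.gl 1 K).Adelic from u) = 1 := by
    intro u hu
    have h := π.1.eq_of_sub_smul_mem (hω (show (AdelicGroupData.gl 1 K).Adelic from u)) hφW hφW'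
      (b := 1) (by rw [hφfix u hu, one_smul, sub_self]; exact π.1.W'.zero_mem)
    exact Units.val_eq_one.mp h
  -- the archimedean exponents: `(T τ).map a = {-λ_τ}`, so `n_τ = λ_τ`
  have hk : ∀ τ : K →+* ℂ, (T τ).map ArchWeight.a = {((-(lam τ 0) : ℤ) : ℂ)} := by
    intro τ
    rw [hTa τ, map_a_cohomologicalInfinityType_one, weight_dual_zero_one]
  obtain ⟨p, q, hpq, hemb⟩ :=
    exists_hasInfinityType_embExponent_eq π.1 hχH hT (fun τ => -(lam τ 0)) hk
  -- the finite part `χ = ω ∘ (1, ·)`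
  refine ⟨ω.comp (GLn.ofFinite 1 K), fun u hu => hωK _ (mem_finitePrincipalCongruenceLevel_iff.mp hu),
    fun γ => ?_, fun v hv α hα i hi => ?_⟩
  · have hpos : ∀ φ : K →+* ℝ,
        0 < φ ((Matrix.GeneralLinearGroup.det (γ : GL (Fin 1) K) : Kˣ) : K) :=
      (mem_glTotPos_iff _).1 γ.2
    have h := heckeCharacter_det_ofFinite_globalEmbedding_eq hpq (γ : GL (Fin 1) K) hpos
    refine h.trans (Finset.prod_congr rfl fun τ _ => ?_)
    rw [hemb τ, neg_neg]
  · exact π.1.quasiCharacter_heckeElement_eq_of_hasSatakeParamAt hω h𝔫 hωK hv hα hi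

/-! ### Cohomological side -/

/-- A pure tensor of non-zero vectors of vector spaces over a field (finite index type) is
non-zero (evaluate the functional `dualDistrib (⊗_i f_i)` with `f_i(m_i) = 1`). [folklore] -/
private theorem piTensorProduct_tprod_ne_zero {k ι : Type*} [Field k] [Fintype ι]
    {M : ι → Type*} [∀ i, AddCommGroup (M i)] [∀ i, Module k (M i)] (m : ∀ i, M i)
    (hm : ∀ i, m i ≠ 0) : (PiTensorProduct.tprod k m : ⨂[k] i, M i) ≠ 0 := by
  choose f hf using fun i => Module.Projective.exists_dual_eq_one k (hm i)
  intro h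
  have h1 : PiTensorProduct.dualDistrib (⨂ₜ[k] i, f i) (⨂ₜ[k] i, m i) = ∏ i, (f i) (m i) :=
    PiTensorProduct.dualDistrib_apply f m
  rw [h, map_zero, Finset.prod_eq_one fun i _ => hf i] at h1
  exact zero_ne_one h1

/-- A pure tensor `⊗_τ w_τ ∈ E_λ(k)` of non-zero vectors `w_τ ∈ V_{λ_τ}(k)` is non-zero. [folklore] -/
private theorem coeffModule_tprod_ne_zero {k : Type} [Field k] {n : ℕ} {K : Type} [Field K]
    [NumberField K] [CharZero k] {lam : (K →+* k) → Fin n → ℤ}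
    (w : ∀ τ : K →+* k, GLnCohomology.CoeffModule k n (lam τ)) (hw : ∀ τ, w τ ≠ 0) :
    CoeffModule.tprod w ≠ 0 := by
  intro h
  exact piTensorProduct_tprod_ne_zero (k := k) w hw h

/-- For `n = 1` the factor `V_{λ_τ}(ℂ)` of `E_λ(ℂ)` is a line on which `g ∈ GL₁(K)` acts (through
`τ`) by the scalar `τ(det g)^{λ_τ(0)}`. [folklore] -/
private theorem coeffRepGL_one_map_apply {K : Type} [Field K] (lam : (K →+* ℂ) → Fin 1 → ℤ)
    (τ : K →+* ℂ) (g : GL (Fin 1) K) (w : GLnCohomology.CoeffModule ℂ 1 (lam τ)) :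
    GLnCohomology.coeffRepGL ℂ 1 (lam τ) (Matrix.GeneralLinearGroup.map (τ : K →+* ℂ) g) w =
      (τ ((Matrix.GeneralLinearGroup.det g : Kˣ) : K)) ^ (lam τ 0) • w := by
  rw [GLnCohomology.coeffRepGL_apply, GLnCohomology.weylRepCoeff_one_apply,
    Matrix.GeneralLinearGroup.map_det, GLnCohomology.lowestEntry_succ, Units.val_zpow_eq_zpow_val,
    Units.coe_map]
  rfl

/-- For `n = 1`, `γ ∈ GL₁(K)⁺` acts on the pure tensor `⊗_τ w_τ ∈ E_λ(ℂ)` by the scalar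
`∏_τ τ(det γ)^{λ_τ(0)}`. [folklore] -/
private theorem coeffRepPos_one_tprod {K : Type} [Field K] [NumberField K]
    (lam : (K →+* ℂ) → Fin 1 → ℤ)
    (γ : glTotPos 1 K) (w : ∀ τ : K →+* ℂ, GLnCohomology.CoeffModule ℂ 1 (lam τ)) :
    coeffRepPos ℂ 1 K lam γ (CoeffModule.tprod w) =
      (∏ τ : K →+* ℂ,
          (τ ((Matrix.GeneralLinearGroup.det (γ : GL (Fin 1) K) : Kˣ) : K)) ^ (lam τ 0)) •
        CoeffModule.tprod w := by
  rw [coeffRepPos_apply, coeffRep_apply_tprod]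
  have key : (fun τ : K →+* ℂ => GLnCohomology.coeffRepGL ℂ 1 (lam τ)
      (Matrix.GeneralLinearGroup.map (τ : K →+* ℂ) (γ : GL (Fin 1) K)) (w τ)) =
      fun τ : K →+* ℂ =>
        (τ ((Matrix.GeneralLinearGroup.det (γ : GL (Fin 1) K) : Kˣ) : K)) ^ (lam τ 0) • w τ :=
    funext fun τ => coeffRepGL_one_map_apply lam τ (γ : GL (Fin 1) K) (w τ)
  rw [key]
  exact (PiTensorProduct.tprod ℂ).map_smul_univ _ _

/-- **Eigenclasses in `H⁰(S_{K_f(𝔫)}, Ẽ_λ)` from finite characters (`n = 1`).**  A character `χ` of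
`GL₁(𝔸_K^∞)` trivial on `K_f(𝔫)` and equal to `∏_τ τ(det γ)^{λ_τ(0)}` on `GL₁(K)⁺` (the action of
`GL₁(K)⁺` on the line `E_λ(ℂ) = ⊗_τ det^{λ_τ}`) gives the non-zero class of `c ↦ χ(c) w₀` in
`H⁰(S_{K_f(𝔫)}, Ẽ_λ) = levelCohomology ℂ 1 K 𝔫 λ 0` with `T_g x = χ(g) x` for every
`g ∈ GL₁(𝔸_K^∞)` (`TwistedQuotient.exists_eigenclass_of_character`). [cite: RaghuramShahidi2010, §2.2] -/
theorem exists_eigenclass_of_finiteCharacter_glOne (K : Type) [Field K] [NumberField K]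
    (𝔫 : Ideal (𝓞 K)) (lam : (K →+* ℂ) → Fin 1 → ℤ) (χ : FiniteAdelicGL 1 K →* ℂˣ)
    (hL : ∀ u ∈ level 1 K 𝔫, χ u = 1)
    (hΓ : ∀ γ : glTotPos 1 K, ((χ (diagPos 1 K γ) : ℂˣ) : ℂ) =
      ∏ τ : K →+* ℂ, (τ ((Matrix.GeneralLinearGroup.det (γ : GL (Fin 1) K) : Kˣ) : K)) ^ (lam τ 0)) :
    ∃ x : levelCohomology ℂ 1 K 𝔫 lam 0, x ≠ 0 ∧
      ∀ g : FiniteAdelicGL 1 K, heckeOp ℂ 1 K 𝔫 lam 0 g x = ((χ g : ℂˣ) : ℂ) • x := by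
  choose w hw using fun τ : K →+* ℂ => GLnCohomology.exists_ne_zero_coeffModule ℂ (lam τ)
  have hw₀ : CoeffModule.tprod w ≠ 0 := coeffModule_tprod_ne_zero w hw
  have hρ : ∀ γ : glTotPos 1 K, coeffRepPos ℂ 1 K lam γ (CoeffModule.tprod w) =
      ((χ (diagPos 1 K γ) : ℂˣ) : ℂ) • CoeffModule.tprod w := fun γ => by
    rw [coeffRepPos_one_tprod, hΓ γ]
  have hcomm : ∀ a b : FiniteAdelicGL 1 K, a * b = b * a := fun a b => GL_fin_one_mul_comm a b
  obtain ⟨x, hx0, hx⟩ :=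
    TwistedQuotient.exists_eigenclass_of_character (V := CoeffModule ℂ 1 K lam) (diagPos 1 K)
      (level 1 K 𝔫) (coeffRepPos ℂ 1 K lam) hcomm χ hL (CoeffModule.tprod w) hw₀ hρ
  exact ⟨x, hx0, fun g => hx g⟩

/-! ### Assembly: the fact in rank one -/

/-- **`ResGLnCohomology.cuspidalEigenclass_exists` with `n = 1`**, binders exactly as in the fact
(the dominance hypothesis is vacuous in rank one and unused): for every number field `K`, level
`𝔫 ≠ 0`, weight `λ = (λ_τ)_τ` and cuspidal `π` on `GL₁(𝔸_K)` of cohomological type `λ^∨` with a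
`K(𝔫)`-fixed form, the class of its finite Hecke character in `H⁰(S_{K_f(𝔫)}, Ẽ_λ)` is a non-zero
simultaneous `T_{v,i}`-eigenclass with the Satake–Tamagawa eigenvalues (`q = 0`; Eichler–Shimura–Harder
in degree `0`: algebraic Hecke characters in `H⁰` of the arithmetic quotients of the torus).
[cite: RaghuramShahidi2010, §2.2] [cite: Clozel1990, §3.5 (n = 1)] -/
theorem cuspidalEigenclass_exists_rank_one :
    ∀ (K : Type) [Field K] [NumberField K] (hcpt : isCompact_glFiniteIntegralLevel 1 K)
      (𝔫 : Ideal (𝓞 K)) (lam : (K →+* ℂ) → Fin 1 → ℤ), 1 ≤ 1 → 𝔫 ≠ 0 →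
      (∀ τ, Weight.IsDominant (lam τ)) →
      ∀ π : CuspidalAutomorphicRepData 1 K hcpt,
        (∃ T : InfinityType K 1, π.1.HasInfinityType T ∧
          ∀ τ : K →+* ℂ, (T τ).map ArchWeight.a =
            (cohomologicalInfinityType 1 K (Weight.dual (lam τ)) τ).map ArchWeight.a) →
        (∃ φ ∈ π.1.W, φ ∉ π.1.W' ∧
          ∀ u ∈ principalCongruenceLevel 1 K 𝔫, rightTranslation (AdelicGroupData.gl 1 K) u φ = φ) →
        ∃ (q : ℕ) (x : levelCohomology ℂ 1 K 𝔫 lam q), x ≠ 0 ∧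
          ∀ v : HeightOneSpectrum (𝓞 K), ¬ v.asIdeal ∣ 𝔫 → ∀ α : Multiset ℂ,
            π.1.HasSatakeParamAt v α → ∀ i ≤ 1,
              heckeT ℂ 1 K 𝔫 lam q v i x = heckeEigenvalueOf 1 v α i • x := by
  intro K _ _ hcpt 𝔫 lam _ h𝔫 _ π hT hfix
  obtain ⟨χ, hL, hΓ, hSat⟩ := exists_finiteCharacter_of_cuspidal_glOne K hcpt 𝔫 lam h𝔫 π hT hfix
  obtain ⟨x, hx0, hxT⟩ := exists_eigenclass_of_finiteCharacter_glOne K 𝔫 lam χ hL hΓ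
  refine ⟨0, x, hx0, fun v hv α hα i hi => ?_⟩
  change heckeOp ℂ 1 K 𝔫 lam 0 (heckeElement 1 K v i) x = _
  rw [hxT, hSat v hv α hα i hi]

end ResGLnCohomology

end Literature.NumberTheory.Automorphic

end
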